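import Summits.NavierStokesRegularity.NavierStokesRegularity.Theses.AxisymmetricExtremality
import Literature.Analysis.FluidPDE.AxisymmetricReflection

/-!
# Strategist s5 — typed attempts behind STRATEGY-CENSUS-s5.md (crux `AxisymmetricKatoGlobal`,
item stmt-NavierStokesRegularity-15453, route `AxisymmetricExtremality`).

Nothing here is a new route or a new line; these are the signatures the census refers to,
kernel-checked so that the logical claims of the census ("`closes` consumes only W₀",
"the no-swirl variant of the assembly is pure logic over `hasNoSwirl_iff_reflY`") are not prose.
-/

namespace Summit.NavierStokesRegularity.NavierStokesRegularity.Cruxes.AxisymmetricKatoGlobal.StrategistS5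

open MeasureTheory
open Literature.Analysis.FluidPDE Literature.Analysis.FunctionSpaces
open Summit.NavierStokesRegularity.NavierStokesRegularity.Theses.AxisymmetricExtremality

local notation "ℝ³" => EuclideanSpace ℝ (Fin 3)
local notation "ℂ³" => EuclideanSpace ℂ (Fin 3)

/-! ## Weaker intermediate: W₀ = "no axisymmetric minimal blow-up datum" -/

/-- **W₀.** The weakest statement the route's deciding theorem actually consumes from the crux:
there is no `Ḣ^{1/2}`-minimal blow-up datum which is axisymmetric. -/
def NoAxisymMinimalDatum : Prop :=
  ∀ ν : ℝ, 0 < ν → ∀ (u₀ : ℝ³ → ℝ³) (g : HomSobolev ℝ³ ℂ³ (1 / 2 : ℝ)),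
    IsMinimalBlowupDatum ν u₀ g → IsAxisymmetric u₀ → False

/-- The crux implies W₀ (one line: the minimality clause `¬ HasGlobalKatoSolution`). -/
theorem noAxisymMinimalDatum_of_crux (h : AxisymmetricKatoGlobal) : NoAxisymMinimalDatum := by
  intro ν hν u₀ g hmin hax
  obtain ⟨hL3, hrep, hdiv, -, hnot⟩ := hmin
  exact hnot (h ν hν u₀ g hL3 hrep hdiv hax)

/-- `closes` factors through W₀: the route needs the crux only at a minimal axisymmetric datum. -/
theorem closes_of_W0 (h₂ : MinimalDatumPFold) (h₄ : PFoldToAxisymmetric)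
    (h₀ : NoAxisymMinimalDatum) : NavierStokesRegularity := by
  show Literature.NS.NavierStokesExistenceSmoothR3
  intro ν hν u₀ hsm hdiv hdec
  by_contra hno
  obtain ⟨u₁, g, hmin, hax⟩ := h₄ ν hν (h₂ ν hν ⟨u₀, hsm, hdiv, hdec, hno⟩)
  exact h₀ ν hν u₁ g hmin hax

/-! ## Route-level variant recorded for the tenure planner (NOT a strategist output):
run the symmetry step with the dihedral groups `D_p ⊂ O(2)` so that the limiting minimal datum is
`O(2)`-equivariant, i.e. axisymmetric WITHOUT swirl (`IsAxisymmetric.hasNoSwirl_iff_reflY`). -/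

/-- p-fold AND meridian-reflection symmetric minimal blow-up data for unboundedly many `p`
(the dihedral analogue of `MinimalDatumPFold`; would come from Smith theory with `ℤ/2`-coefficients
applied to `D_{2^k}`). -/
def MinimalDatumDihedral : Prop :=
  ∀ ν : ℝ, 0 < ν →
    (∃ v₀ : ℝ³ → ℝ³, ContDiff ℝ (⊤ : ℕ∞) v₀ ∧ NSWave0.IsDivFree v₀ ∧ HasRapidSpatialDecay v₀ ∧
      ¬ ∃ (u : ℝ → ℝ³ → ℝ³) (p : ℝ → ℝ³ → ℝ), IsSmoothOnHalfSpace u ∧ IsSmoothOnHalfSpace p ∧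
        IsNavierStokesSolution ν 0 v₀ u p ∧ HasBoundedEnergy u) →
    ∀ N : ℕ, ∃ p : ℕ, N ≤ p ∧ 2 ≤ p ∧ ∃ (u₀ : ℝ³ → ℝ³) (g : HomSobolev ℝ³ ℂ³ (1 / 2 : ℝ)),
      IsMinimalBlowupDatum ν u₀ g ∧ (∀ x, u₀ (rotZ (2 * Real.pi / p) x) = rotZ (2 * Real.pi / p) (u₀ x)) ∧
        ∀ x, u₀ (reflY x) = reflY (u₀ x)

/-- Dihedral-to-`O(2)` closure step (the analogue of the PROVED `PFoldToAxisymmetric`: compactness of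
`M̂` modulo similarities + closedness of the fixed locus; the reflection passes to the limit as the
rotations do). -/
def DihedralToO2 : Prop :=
  ∀ ν : ℝ, 0 < ν →
    (∀ N : ℕ, ∃ p : ℕ, N ≤ p ∧ 2 ≤ p ∧ ∃ (u₀ : ℝ³ → ℝ³) (g : HomSobolev ℝ³ ℂ³ (1 / 2 : ℝ)),
      IsMinimalBlowupDatum ν u₀ g ∧ (∀ x, u₀ (rotZ (2 * Real.pi / p) x) = rotZ (2 * Real.pi / p) (u₀ x)) ∧
        ∀ x, u₀ (reflY x) = reflY (u₀ x)) →
    ∃ (u₀ : ℝ³ → ℝ³) (g : HomSobolev ℝ³ ℂ³ (1 / 2 : ℝ)),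
      IsMinimalBlowupDatum ν u₀ g ∧ IsAxisymmetric u₀ ∧ ∀ x, u₀ (reflY x) = reflY (u₀ x)

/-- **AX_H without swirl, Kato class.** Global Kato solutions for `L³ ∩ Ḣ^{1/2}`, weakly
divergence-free, axisymmetric data WITHOUT swirl. In print for inhomogeneous `H^{1/2}` data
(Abidi 2008, cited in Lemarié-Rieusset 2016 p. 285); the tree theorem
`axisymmetric_no_swirl_global_regularity_holds` is the Clay-class (smooth, rapidly decaying) form. -/
def NoSwirlKatoGlobal : Prop :=
  ∀ ν : ℝ, 0 < ν → ∀ (u₀ : ℝ³ → ℝ³) (g : HomSobolev ℝ³ ℂ³ (1 / 2 : ℝ)),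
    MemLp u₀ 3 volume → g.Represents (Literature.Analysis.FunctionSpaces.EuclideanSpace.complexify ∘ u₀) →
      IsWeaklyDivFree u₀ → IsAxisymmetric u₀ → HasNoSwirl u₀ → HasGlobalKatoSolution ν u₀

/-- The crux trivially contains its no-swirl instance. -/
theorem noSwirlKatoGlobal_of_crux (h : AxisymmetricKatoGlobal) : NoSwirlKatoGlobal :=
  fun ν hν u₀ g hL3 hrep hdiv hax _ => h ν hν u₀ g hL3 hrep hdiv hax

/-- **The dihedral assembly is pure logic** over the tree lemma
`IsAxisymmetric.hasNoSwirl_of_reflY_eq` (Literature/Analysis/FluidPDE/AxisymmetricReflection). -/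
theorem closes_noSwirl (h₂ : MinimalDatumDihedral) (h₄ : DihedralToO2) (h₃ : NoSwirlKatoGlobal) :
    NavierStokesRegularity := by
  show Literature.NS.NavierStokesExistenceSmoothR3
  intro ν hν u₀ hsm hdiv hdec
  by_contra hno
  obtain ⟨u₁, g, hmin, hax, hσ⟩ := h₄ ν hν (h₂ ν hν ⟨u₀, hsm, hdiv, hdec, hno⟩)
  obtain ⟨hL3, hrep, hdiv₁, -, hnot⟩ := hmin
  exact hnot (h₃ ν hν u₁ g hL3 hrep hdiv₁ hax (hax.hasNoSwirl_of_reflY_eq hσ))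

/-! ## Decomposition attempt D1 (swirl dichotomy on the DATUM) — recorded as costume:
`Sub₂` is the crux minus a literature-routine case. -/

/-- Data with swirl somewhere. -/
def SwirlingKatoGlobal : Prop :=
  ∀ ν : ℝ, 0 < ν → ∀ (u₀ : ℝ³ → ℝ³) (g : HomSobolev ℝ³ ℂ³ (1 / 2 : ℝ)),
    MemLp u₀ 3 volume → g.Represents (Literature.Analysis.FunctionSpaces.EuclideanSpace.complexify ∘ u₀) →
      IsWeaklyDivFree u₀ → IsAxisymmetric u₀ → ¬ HasNoSwirl u₀ → HasGlobalKatoSolution ν u₀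

/-- The split `NoSwirlKatoGlobal → SwirlingKatoGlobal → AxisymmetricKatoGlobal` is proved by cases —
and is exactly why it carries no content: `SwirlingKatoGlobal` is the whole crux. -/
theorem crux_of_dichotomy (h₁ : NoSwirlKatoGlobal) (h₂ : SwirlingKatoGlobal) : AxisymmetricKatoGlobal := by
  intro ν hν u₀ g hL3 hrep hdiv hax
  by_cases hsw : HasNoSwirl u₀
  · exact h₁ ν hν u₀ g hL3 hrep hdiv hax hsw
  · exact h₂ ν hν u₀ g hL3 hrep hdiv hax hsw

end Summit.NavierStokesRegularity.NavierStokesRegularity.Cruxes.AxisymmetricKatoGlobal.StrategistS5
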